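import Mathlib
import HarnessLib

/-!
# Straight-line programs with division over a field, and derivability with a cost budget

Topic `Computability/AlgebraicComplexity`. The *semantic* straight-line-program model of
Bürgisser–Clausen–Shokrollahi 1997, Def. (4.2)/(4.4) with the operation set `Ω = k ∪ {+, −, *, /}`
(computations in a field `K` that is a `k`-algebra; scalars of `k` and `k`-linear operations,
products, and divisions by nonzero elements), in the same "available set / result sequence" style as
the division-free polynomial model `ArithCircuit.FanInTwoSeq` of `MatMulTotalComplexityProofs.lean`:

* `DivStep k A v`: `v` is one `Ω`-step from the available set `A` (constants `algebraMap k K c` are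
  always available): a linear combination `c • x + d • y` (`c d : k`), a product `x * y`, or the
  inverse `x⁻¹` of a nonzero `x`. (A division `x / y` is the two steps `y⁻¹`, `x * y⁻¹`; BCS count it
  as one — all cost statements downstream are up to constant factors.)
* `DivSeq k A l`: the list `l` is a computation sequence over `A` (each entry one step from `A` and
  the earlier entries).
* `Derivable k n A B`: every element of `B` is available after some computation sequence over `A` of
  length at most `n` ("`B` is computable from `A` with at most `n` operations, constants free").

The point of the model (BCS97 §7.1, Strassen 1973): over `K = Frac k[X]` a computation sequence with
divisions is simulated by a division-free arithmetic circuit on numerator/denominator pairs of at most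
four times the length (`DivisionSLPPairs`, separate file); so upper bounds proved comfortably over a
FIELD transfer to the tree's division-free `complexity` up to a nonzero polynomial factor.

This file: the three definitions and their structural API (monotonicity, concatenation,
transitivity, unions, the one-step rules, finite weighted sums). No algorithm lives here.

## References
* P. Bürgisser, M. Clausen, M. A. Shokrollahi, *Algebraic Complexity Theory*, Springer 1997,
  Def. (4.2) (straight-line programs over `Ω`-algebras), (4.4) (computation sequences), §7.1.
* V. Strassen, *Vermeidung von Divisionen*, J. reine angew. Math. 264 (1973) 184–202.
-/

namespace Literature.Computability.AlgebraicComplexity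

universe u v

open scoped BigOperators

section Defs

variable (k : Type u) {K : Type v} [CommSemiring k] [Field K] [Algebra k K]

/-- One `Ω`-step, `Ω = k ∪ {+,−,*,/}` (BCS 1997, Def. (4.2)/(4.4)): `v` is a `k`-linear combination
`c • x + d • y`, a product `x * y`, or the inverse `x⁻¹` of a nonzero `x`, of elements `x, y` that are
available (`∈ A`) or constants (`algebraMap k K c`). [cite: BurgisserClausenShokrollahi1997, Def. (4.4)] -/
def DivStep (A : Set K) (v : K) : Prop :=
  ∃ x ∈ A ∪ Set.range (algebraMap k K), ∃ y ∈ A ∪ Set.range (algebraMap k K),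
    (∃ c d : k, v = c • x + d • y) ∨ v = x * y ∨ (x ≠ 0 ∧ v = x⁻¹)

/-- A computation sequence over the available set `A` (BCS 1997, Def. (4.4)): each entry of the list
is one `Ω`-step from `A` and the earlier entries. [cite: BurgisserClausenShokrollahi1997, Def. (4.4)] -/
def DivSeq : Set K → List K → Prop
  | _, [] => True
  | A, v :: l => DivStep k A v ∧ DivSeq (insert v A) l

/-- `Derivable k n A B`: the elements of `B` are computable from `A` by ONE computation sequence of
length at most `n` (constants of `k` free) — the cost predicate `L_Ω(B mod A) ≤ n` of BCS 1997,
Def. (4.7), in relational form. [cite: BurgisserClausenShokrollahi1997, Def. (4.7)] -/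
def Derivable (n : ℕ) (A B : Set K) : Prop :=
  ∃ l : List K, DivSeq k A l ∧ l.length ≤ n ∧
    B ⊆ A ∪ Set.range (algebraMap k K) ∪ {x | x ∈ l}

end Defs

/-! ### Structural API -/

section API

variable {k : Type u} {K : Type v} [CommSemiring k] [Field K] [Algebra k K]

/-- Unfolding a computation sequence at its head. [cite: BurgisserClausenShokrollahi1997, Def. (4.4)] -/
@[simp] theorem divSeq_nil (A : Set K) : DivSeq k A [] := trivial

/-- Unfolding a computation sequence at its head. [cite: BurgisserClausenShokrollahi1997, Def. (4.4)] -/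
theorem divSeq_cons {A : Set K} {v : K} {l : List K} :
    DivSeq k A (v :: l) ↔ DivStep k A v ∧ DivSeq k (insert v A) l := Iff.rfl

/-- A step from `A` is a step from any larger set. [folklore] -/
theorem DivStep.mono {A B : Set K} (hAB : A ⊆ B) {v : K} (h : DivStep k A v) : DivStep k B v := by
  obtain ⟨x, hx, y, hy, hv⟩ := h
  exact ⟨x, Set.union_subset_union_left _ hAB hx, y, Set.union_subset_union_left _ hAB hy, hv⟩

/-- A computation sequence over `A` is one over any larger set. [folklore] -/
theorem DivSeq.mono {l : List K} : ∀ {A B : Set K}, A ⊆ B → DivSeq k A l → DivSeq k B l := by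
  induction l with
  | nil => intros; trivial
  | cons v l ih =>
    intro A B hAB h
    exact ⟨h.1.mono hAB, ih (Set.insert_subset_insert hAB) h.2⟩

/-- Concatenation of computation sequences. [folklore] -/
theorem DivSeq.append {l₁ l₂ : List K} :
    ∀ {A : Set K}, DivSeq k A l₁ → DivSeq k (A ∪ {x | x ∈ l₁}) l₂ → DivSeq k A (l₁ ++ l₂) := by
  induction l₁ with
  | nil =>
    intro A _ h₂
    refine DivSeq.mono ?_ h₂
    intro x hx
    rcases hx with hx | hx
    · exact hx
    · simp at hx
  | cons v l₁ ih =>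
    intro A h₁ h₂
    refine ⟨h₁.1, ih h₁.2 (h₂.mono ?_)⟩
    rintro x (hx | hx)
    · exact Or.inl (Set.mem_insert_of_mem _ hx)
    · simp only [Set.mem_setOf_eq, List.mem_cons] at hx
      rcases hx with rfl | hx
      · exact Or.inl (Set.mem_insert _ _)
      · exact Or.inr hx

/-- The elements of a computation sequence over `A` only ever use `A`: restricting the available set
to `A` inside `A ∪ consts` changes nothing — constants are built into `DivStep`. [folklore] -/
theorem DivSeq.of_union_consts {l : List K} :
    ∀ {A : Set K}, DivSeq k (A ∪ Set.range (algebraMap k K)) l → DivSeq k A l := by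
  induction l with
  | nil => intros; trivial
  | cons v l ih =>
    intro A h
    refine ⟨?_, ih ?_⟩
    · obtain ⟨x, hx, y, hy, hv⟩ := h.1
      refine ⟨x, ?_, y, ?_, hv⟩
      · rcases hx with (hx | hx) | hx <;> simp [hx]
      · rcases hy with (hy | hy) | hy <;> simp [hy]
    · refine h.2.mono ?_
      intro x hx
      rcases (Set.mem_insert_iff.1 hx) with rfl | (hx | hx)
      · exact Or.inl (Set.mem_insert _ _)
      · exact Or.inl (Set.mem_insert_of_mem _ hx)
      · exact Or.inr hx

/-- Weakening of derivability: larger source, smaller target, larger budget. [folklore] -/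
theorem Derivable.mono {n n' : ℕ} {A A' B B' : Set K} (h : Derivable k n A B) (hn : n ≤ n')
    (hA : A ⊆ A') (hB : B' ⊆ B) : Derivable k n' A' B' := by
  obtain ⟨l, hl, hlen, hsub⟩ := h
  refine ⟨l, hl.mono hA, hlen.trans hn, hB.trans (hsub.trans ?_)⟩
  exact Set.union_subset_union_left _ (Set.union_subset_union_left _ hA)

/-- What is already available (or a constant) is derivable at no cost. [folklore] -/
theorem Derivable.of_subset {A B : Set K} (h : B ⊆ A ∪ Set.range (algebraMap k K)) (n : ℕ) :
    Derivable k n A B :=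
  ⟨[], trivial, Nat.zero_le _, h.trans Set.subset_union_left⟩

/-- Reflexivity. [folklore] -/
theorem Derivable.refl (A : Set K) (n : ℕ) : Derivable k n A A :=
  Derivable.of_subset (Set.subset_union_left) n

/-- Constants are derivable at no cost. [folklore] -/
theorem Derivable.consts (A : Set K) (n : ℕ) : Derivable k n A (Set.range (algebraMap k K)) :=
  Derivable.of_subset Set.subset_union_right n

/-- **Transitivity with additive cost**: derive `B` from `A`, then `C` from `A ∪ B`. [folklore] -/
theorem Derivable.trans {m n : ℕ} {A B C : Set K} (h₁ : Derivable k m A B)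
    (h₂ : Derivable k n (A ∪ B) C) : Derivable k (m + n) A C := by
  obtain ⟨l₁, hl₁, hlen₁, hsub₁⟩ := h₁
  obtain ⟨l₂, hl₂, hlen₂, hsub₂⟩ := h₂
  have hAB : A ∪ B ⊆ (A ∪ {x | x ∈ l₁}) ∪ Set.range (algebraMap k K) := by
    rintro x (hx | hx)
    · exact Or.inl (Or.inl hx)
    · rcases hsub₁ hx with (h | h) | h
      · exact Or.inl (Or.inl h)
      · exact Or.inr h
      · exact Or.inl (Or.inr h)
  refine ⟨l₁ ++ l₂, hl₁.append (DivSeq.of_union_consts ((hl₂.mono hAB))), ?_, ?_⟩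
  · simp only [List.length_append]; omega
  · intro x hx
    rcases hsub₂ hx with (h | h) | h
    · rcases hAB h with (h' | h') | h'
      · exact Or.inl (Or.inl h')
      · exact Or.inr (List.mem_append.2 (Or.inl h'))
      · exact Or.inl (Or.inr h')
    · exact Or.inl (Or.inr h)
    · exact Or.inr (List.mem_append.2 (Or.inr h))

/-- Deriving two targets from the same source costs at most the sum. [folklore] -/
theorem Derivable.union {m n : ℕ} {A B C : Set K} (h₁ : Derivable k m A B)
    (h₂ : Derivable k n A C) : Derivable k (m + n) A (B ∪ C) := by
  have h₂' : Derivable k n (A ∪ B) (B ∪ C) := by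
    obtain ⟨l, hl, hlen, hsub⟩ := h₂
    refine ⟨l, hl.mono Set.subset_union_left, hlen, ?_⟩
    rintro x (hx | hx)
    · exact Or.inl (Or.inl (Or.inr hx))
    · rcases hsub hx with (h | h) | h
      · exact Or.inl (Or.inl (Or.inl h))
      · exact Or.inl (Or.inr h)
      · exact Or.inr h
  exact h₁.trans h₂'

/-- Deriving finitely many targets from the same source costs at most the sum of the costs. [folklore] -/
theorem Derivable.biUnion {ι : Type*} (s : Finset ι) {c : ι → ℕ} {A : Set K} {B : ι → Set K}
    (h : ∀ i ∈ s, Derivable k (c i) A (B i)) : Derivable k (∑ i ∈ s, c i) A (⋃ i ∈ s, B i) := by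
  classical
  induction s using Finset.induction_on with
  | empty => exact Derivable.of_subset (by simp) _
  | insert a s ha ih =>
    rw [Finset.sum_insert ha, Finset.set_biUnion_insert]
    exact (h a (Finset.mem_insert_self a s)).union (ih fun i hi => h i (Finset.mem_insert_of_mem hi))

/-- One step gives derivability at cost one. [folklore] -/
theorem Derivable.of_divStep {A : Set K} {v : K} (h : DivStep k A v) : Derivable k 1 A {v} :=
  ⟨[v], ⟨h, trivial⟩, le_rfl, by intro x hx; simp only [Set.mem_singleton_iff] at hx; simp [hx]⟩

/-- **Linear combination**: `c • x + d • y` costs one step. [cite: BurgisserClausenShokrollahi1997, Def. (4.4)] -/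
theorem Derivable.lin {A : Set K} {x y : K} (hx : x ∈ A ∪ Set.range (algebraMap k K))
    (hy : y ∈ A ∪ Set.range (algebraMap k K)) (c d : k) : Derivable k 1 A {c • x + d • y} :=
  Derivable.of_divStep ⟨x, hx, y, hy, Or.inl ⟨c, d, rfl⟩⟩

/-- **Product**: `x * y` costs one step. [cite: BurgisserClausenShokrollahi1997, Def. (4.4)] -/
theorem Derivable.mul {A : Set K} {x y : K} (hx : x ∈ A ∪ Set.range (algebraMap k K))
    (hy : y ∈ A ∪ Set.range (algebraMap k K)) : Derivable k 1 A {x * y} :=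
  Derivable.of_divStep ⟨x, hx, y, hy, Or.inr (Or.inl rfl)⟩

/-- **Inverse**: `x⁻¹` of a nonzero `x` costs one step. [cite: BurgisserClausenShokrollahi1997, Def. (4.4)] -/
theorem Derivable.inv {A : Set K} {x : K} (hx : x ∈ A ∪ Set.range (algebraMap k K)) (hx0 : x ≠ 0) :
    Derivable k 1 A {x⁻¹} :=
  Derivable.of_divStep ⟨x, hx, x, hx, Or.inr (Or.inr ⟨hx0, rfl⟩)⟩

/-- Addition costs one step. [folklore] -/
theorem Derivable.add {A : Set K} {x y : K} (hx : x ∈ A ∪ Set.range (algebraMap k K))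
    (hy : y ∈ A ∪ Set.range (algebraMap k K)) : Derivable k 1 A {x + y} := by
  simpa using Derivable.lin hx hy (1 : k) (1 : k)

/-- Scalar multiples cost one step. [folklore] -/
theorem Derivable.smul {A : Set K} {x : K} (hx : x ∈ A ∪ Set.range (algebraMap k K)) (c : k) :
    Derivable k 1 A {c • x} := by
  simpa using Derivable.lin hx hx c (0 : k)

/-- **Finite weighted sums**: `∑_{i ∈ s} c_i • x_i` of available elements costs at most `|s|`
steps. [folklore] -/
theorem Derivable.sum {ι : Type*} (s : Finset ι) (c : ι → k) {A : Set K} {x : ι → K}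
    (hx : ∀ i ∈ s, x i ∈ A ∪ Set.range (algebraMap k K)) :
    Derivable k s.card A {∑ i ∈ s, c i • x i} := by
  classical
  induction s using Finset.induction_on with
  | empty =>
    refine Derivable.of_subset ?_ _
    intro v hv
    simp only [Finset.sum_empty, Set.mem_singleton_iff] at hv
    exact Or.inr ⟨0, by simp [hv]⟩
  | insert a s ha ih =>
    rw [Finset.card_insert_of_notMem ha, Finset.sum_insert ha]
    have h1 := ih fun i hi => hx i (Finset.mem_insert_of_mem hi)
    refine h1.trans ?_
    have := Derivable.lin (k := k) (A := A ∪ {∑ i ∈ s, c i • x i}) (x := x a)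
      (y := ∑ i ∈ s, c i • x i) ?_ (Or.inl (Or.inr rfl)) (c a) 1
    · simpa using this
    · rcases hx a (Finset.mem_insert_self a s) with h | h
      · exact Or.inl (Or.inl h)
      · exact Or.inr h

end API

end Literature.Computability.AlgebraicComplexity
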